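import Summits.ResolutionOfSingularities.ResolutionOfSingularities.Theorems.FrobeniusClosingPatchingRelPerfectDepthSepFormat
import Summits.ResolutionOfSingularities.ResolutionOfSingularities.Theorems.FrobeniusClosingPatchingRelPerfectDepthFlagFormat
import Summits.ResolutionOfSingularities.ResolutionOfSingularities.Theorems.FrobeniusClosingPatchingRelPerfectDepthFlagDetectsOrder
import Summits.ResolutionOfSingularities.ResolutionOfSingularities.Theorems.FrobeniusClosingPatchingRelPerfectDepthFlagTargets
import Summits.ResolutionOfSingularities.ResolutionOfSingularities.Theorems.FrobeniusClosingPatchingRelPerfectDepthSNCExchange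
import Literature.AlgebraicGeometry.Resolution.BlowupRestrictOpen
import HarnessLib

/-!
# Chain W5.2 — F6: the JUNCTION `InitialSep FlagFormat SepFormat` — END₁ of stage 1 establishes the stage-2 format

[OURS · L1 W5.2 · res-D-pv-016 AS res-L1-w52-stub-5, T6-X2 OWNER (res-L1-w52-plan-1 RULINGS 2026-08-27T09:17:34Z (3), STEER
09:59:52Z / STEER 2 (v)); target T6-J of TargetsF6 module 1 `…DepthFlagTargets` §3.]  NOT a statement of the manuscript under
review; AI-written, weaker than expert review; fact-free.

At a stage-1 state (res-D-pv-052's `DepthInvariant 2`, res-L1-w52-lead-1's `FlagFormat i K R₁`: global host `K = 𝓗 ⊔ 𝓘_E²`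
plus a locally trivial retraction pair `(V, k, r)` whose first coefficient ideal of `K|_V` is `R₁`) with END₁
`EndFlag (K|_E) R₁` (`ord_x (K|_E ⊔ R₁²) ≤ 1` everywhere), the stage-2 format `SepFormat i K ⊤ []` holds:

* the HOST IS REGULAR ALONG `E` — the KEY OBSERVATION of F6-DESIGN-MEMO §1, res-L1-w52-stub-1's
  `DepthFlag.idealOrder_host_le_one_of_flag` (p518040) on the retraction open `V` (`coeffFlag k r 0 (K|_V) = K|_E`,
  `coeffFlag k r 1 (K|_V) = R₁`), carried back to `X` along the open immersion `V.ι` (res-type-002's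
  `idealOrder_comap_of_isOpenImmersion`, (L-B)) and read as `SNCWithAt [𝓗] ⊤ (i z)` (res-type-049's
  `SNCWithAt.singleton_of_span_singleton`, (L-C));
* everything else is res-D-pv-016's `SepFormat.initial_of_hostMonoFormat` (p520204: `[𝓘_E]` snc, transversality and pockets
  vacuous).

`initialSep_flagFormat_sepFormat : InitialSep FlagFormat SepFormat` closes T6-J BY NAME.

## References
* H. Kawanoue, K. Matsuki, Adv. Stud. Pure Math. 70 (2016), §2. [KawanoueMatsuki2016]
* J. Kollár, *Lectures on Resolution of Singularities* (2007), (3.111) Step 3. [Kollar2007]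
* H. Matsumura, *Commutative Ring Theory* (1986), Thm. 14.2. [Matsumura1987]
-/

-- `Summit.<Summit>.<Sub>.Theorems` with `Sub = Summit` (single-conjunct summit, D-0017)
set_option linter.dupNamespace false

noncomputable section

open CategoryTheory CategoryTheory.Limits AlgebraicGeometry TopologicalSpace IsLocalRing
open Literature.AlgebraicGeometry.Resolution
open Scheme.IdealSheafData

namespace Summit.ResolutionOfSingularities.ResolutionOfSingularities.Theorems

universe u

namespace DepthGraded

namespace FlagFormat

/-- [OURS · L1 W5.2] **At END₁ the host of a flag-formatted state is REGULAR ALONG `E`**: `X` regular locally Noetherian,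
`E` regular, `i` a closed immersion with `ker i` effective Cartier, `K = 𝓗 ⊔ 𝓘_E²` (`HostMonoFormat 2 i K 𝓗 ⊤`) in the
flag format with E-datum `R₁`, and `ord_z (K|_E ⊔ R₁²) ≤ 1` at every `z`; then at every point `i z` of the host,
`SNCWithAt [𝓗] ⊤ (i z)` (a generator of `𝓗_{iz}` is a regular parameter). [cite: KawanoueMatsuki2016, §2]
[cite: Matsumura1987, Thm. 14.2] -/
theorem host_sncWithAt_of_endFlag {E X : Scheme.{u}} {i : E ⟶ X} [IsLocallyNoetherian X] [IsClosedImmersion i]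
    (hX : Scheme.IsRegular X) (hE : Scheme.IsRegular E) (hker : IsEffectiveCartier i.ker)
    {K 𝓗 : X.IdealSheafData} {R₁ : E.IdealSheafData} (hfmt : HostMonoFormat 2 i K 𝓗 ⊤) (hQ : FlagFormat i K R₁)
    (hend : ∀ z : E, idealOrder (K.comap i ⊔ R₁ ^ 2) z ≤ 1) (z : E) (hz : i.base z ∈ 𝓗.support) :
    DepthSNC.SNCWithAt [𝓗] ⊤ (i.base z) := by
  obtain ⟨-, V, k, r, hki, hkr, -, hR₁⟩ := hQ
  haveI hkci : IsClosedImmersion k := isClosedImmersion_factor hki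
  have hVreg : Scheme.IsRegular (V : Scheme.{u}) := Scheme.IsRegular.of_isOpenImmersion V.ι hX
  have hkerV : k.ker = i.ker.comap V.ι := ker_factor hki
  have hPc : IsEffectiveCartier k.ker := by rw [hkerV]; exact hker.comap_ι V
  -- `K|_V ≤ 𝓗|_V ⊔ (ker k)²`
  have hKV : K.comap V.ι ≤ 𝓗.comap V.ι ⊔ k.ker ^ 2 := by
    rw [hfmt.2, Scheme.IdealSheafData.comap_sup, comap_mul, Scheme.IdealSheafData.comap_top,
      Scheme.IdealSheafData.top_mul, comap_pow, hkerV]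
  -- the flag hypothesis at `z`
  have hflag : idealOrder (coeffFlag k r 0 (K.comap V.ι) ⊔ coeffFlag k r 1 (K.comap V.ι) ^ 2) z ≤ 1 := by
    rw [coeffFlag_zero, ← Scheme.IdealSheafData.comap_comp, hki, hR₁]
    exact hend z
  -- the host has order one at `k z` on `V`, hence at `i z` on `X`
  have hordV : idealOrder (𝓗.comap V.ι) (k.base z) ≤ 1 :=
    DepthFlag.idealOrder_host_le_one_of_flag k r hkr hKV z (DepthFlag.one_le_idealOrder_ker k z)
      (DepthFlag.idealOrder_ker_le_one k hVreg hE hPc _) hflag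
  have hkz : V.ι.base (k.base z) = i.base z := by
    have h := congrArg (fun φ : E ⟶ X => φ.base z) hki
    simpa only [Scheme.Hom.comp_base, TopCat.coe_comp, Function.comp_apply] using h
  have hord : idealOrder 𝓗 (i.base z) ≤ 1 := by
    rw [← hkz, ← idealOrder_comap_of_isOpenImmersion V.ι 𝓗 (k.base z)]
    exact hordV
  -- read as a regular-parameter generator
  haveI : IsRegularLocalRing (X.presheaf.stalk (i.base z)) := hX _
  obtain ⟨F, -, hF⟩ := hfmt.1.exists_stalkIdeal_eq_span (i.base z)
  have hF𝔪 : F ∈ maximalIdeal (X.presheaf.stalk (i.base z)) :=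
    (mem_support_iff_stalkIdeal_le 𝓗 _).mp hz (hF ▸ Ideal.mem_span_singleton_self F)
  have hF2 : F ∉ maximalIdeal (X.presheaf.stalk (i.base z)) ^ 2 := by
    intro h2
    have hle : stalkIdeal 𝓗 (i.base z) ≤ maximalIdeal _ ^ 2 := by
      rw [hF, Ideal.span_singleton_le_iff_mem]; exact h2
    have h2' : ((2 : ℕ) : ℕ∞) ≤ idealOrder 𝓗 (i.base z) := (le_idealOrder_iff 𝓗 _ 2).mpr hle
    have h3 : ((2 : ℕ) : ℕ∞) ≤ 1 := h2'.trans hord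
    exact absurd h3 (by decide)
  exact DepthSNC.SNCWithAt.singleton_of_span_singleton (hX _) hF hF𝔪 hF2

end FlagFormat

end DepthGraded

namespace DepthTargets

/-- [OURS · L1 W5.2] **T6-J `InitialSep FlagFormat SepFormat` — the junction of the two stages BY NAME**: END₁ of stage 1
(`EndFlag`) puts a flag-formatted state of the depth-two invariant into res-D-pv-016's stage-2 format with unit monomial and empty
boundary. [cite: KawanoueMatsuki2016, §2] [cite: Kollar2007, (3.111) Step 3] -/
theorem initialSep_flagFormat_sepFormat : InitialSep DepthGraded.FlagFormat.{u} DepthGraded.SepFormat.{u} := by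
  intro S _ _ I E X i g K R₁ hinv hQ hend
  haveI := hinv.isNoetherian
  haveI := hinv.isClosedImmersion
  obtain ⟨𝓗, hfmt⟩ := hQ.exists_host
  exact DepthGraded.SepFormat.initial_of_hostMonoFormat hinv.isRegular hinv.isRegular_exc hinv.isEffectiveCartier_ker hfmt
    (DepthGraded.FlagFormat.host_sncWithAt_of_endFlag hinv.isRegular hinv.isRegular_exc hinv.isEffectiveCartier_ker
      hfmt hQ hend)

end DepthTargets

end Summit.ResolutionOfSingularities.ResolutionOfSingularities.Theorems

end
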